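import Literature.Probability.Percolation.LonelyClusterExchange
import HarnessLib

/-!
# `NoHeavyLowerTail` (stmt-CriticalPhenomena-4575) — hull-port line: LSL(2,1) from the BONUS-FREE exchange

Support file (prover `prim-hp-1`; `--supports stmt-CriticalPhenomena-4575`); no definitions, named facts or sorries; general finite
vertex type `V`, any bond weights (pure bookkeeping).  Notation of `…HullPortBonusExchange`: observers `x₁, x₂`, `U = C(x₁) ∪ C(x₂)`,
`R_v = {|π(v)| ≤ j}`, marker `b`, avoided vertex `z`, `D_z = {z ∉ U}`, `Ψ_b = [b ∈ U ∧ R_b] ∨ [b ∉ U ∧ |π(U)| ≤ j]`,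
`G₊ = R_{x₂} ∖ R_{x₁}`, `G₋ = R_{x₁} ∖ R_{x₂}`.

The hypothesis of `HullPort.lsl_pair_of_bonusExchange` (the bonus exchange (i) of crux memo HULLPORT-COUPLING.md §21) is FALSE in
general: every bonus-free four-point exchange that fails lifts, by RELAY DOUBLING (a weight-1 twin for every relay, level
`j ↦ 2j+1`), to a failure with `b ∈ A` (memo §25; exact 13-vertex witnesses).  The selection bookkeeping has more slack than (i)
uses — on `{b ∉ U}` the selected event `{|π(U)| ≤ j}` lies in `R_{x₁} ∩ R_{x₂}` — and keeping it reduces LSL(2,1) to the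
BONUS-FREE exchange

  `μ(D_z, b ∈ C(x₂)∖C(x₁), G₊) · μ(D_z, b ∈ C(x₁)∖C(x₂), G₋) ≤ μ(D_z, b ∉ C(x₁), G₋) · μ(D_z, b ∉ C(x₂), G₊)`,

which holds for relay AND non-relay markers in every census so far (random n ≤ 8, the 9-vertex wheel family, annealing; ≈ 6·10⁴
exact role-cases, 0 violations) and without `z` is four applications of the two-cluster exchange of van den Berg–Häggström–Kahn.

* `HullPort.lsl_pair_le_add'` — `μ(D_z ∩ Ψ_b) ≤ μ(D_z ∩ R_{x₁}) + μ(D_z, b∈C(x₂)∖C(x₁), G₊) − μ(D_z, b∉C(x₁), G₋)`.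
* `HullPort.lsl_pair_of_exchange` — bonus-free exchange ⇒ LSL(2,1) (the hypothesis of `HullPort.threeCluster_scenario_of_LSL`).
[cite: VandenbergHaggstromKahn2005, Thm. 1.5 (p. 7) — context only; this file uses no probabilistic input]
-/

noncomputable section

namespace Summit.CriticalPhenomena.PercolationContinuityZ3.Theorems

open MeasureTheory Set Literature.Probability.LatticeModels Literature.Probability.Percolation
open scoped Classical

variable {V : Type*}

namespace HullPort


/-- **Selection bookkeeping, sharp form.**  `μ(D_z ∩ Ψ_b) ≤ μ(D_z ∩ R_{x₁}) + μ(D_z, b∈C(x₂)∖C(x₁), G₊) − μ(D_z, b ∉ C(x₁), G₋)`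
(the default event `|π(U)| ≤ j` is contained in `R_{x₁} ∩ R_{x₂}`). [folklore] -/
theorem lsl_pair_le_add' [Fintype V] (w : Sym2 V → unitInterval) (A : Finset V) (x₁ x₂ z b : V) (j : ℕ) :
    (prodBernoulli w).real {ω : BondConfig V | ω ∉ openConn x₁ z ∧ ω ∉ openConn x₂ z ∧
        (((ω ∈ openConn x₁ b ∨ ω ∈ openConn x₂ b) ∧ (A.filter fun t => ω ∈ openConn b t).card ≤ j) ∨
          (ω ∉ openConn x₁ b ∧ ω ∉ openConn x₂ b ∧
            (A.filter fun t => ω ∈ openConn x₁ t ∨ ω ∈ openConn x₂ t).card ≤ j))} ≤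
      (prodBernoulli w).real {ω : BondConfig V | ω ∉ openConn x₁ z ∧ ω ∉ openConn x₂ z ∧
          (A.filter fun t => ω ∈ openConn x₁ t).card ≤ j} +
        (prodBernoulli w).real {ω : BondConfig V | ω ∉ openConn x₁ z ∧ ω ∉ openConn x₂ z ∧
            ω ∉ openConn x₁ b ∧ ω ∈ openConn x₂ b ∧
            (A.filter fun t => ω ∈ openConn x₂ t).card ≤ j ∧ ¬ (A.filter fun t => ω ∈ openConn x₁ t).card ≤ j} -
        (prodBernoulli w).real {ω : BondConfig V | ω ∉ openConn x₁ z ∧ ω ∉ openConn x₂ z ∧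
            ω ∉ openConn x₁ b ∧
            (A.filter fun t => ω ∈ openConn x₁ t).card ≤ j ∧ ¬ (A.filter fun t => ω ∈ openConn x₂ t).card ≤ j} := by
  set μ := prodBernoulli w with hμ
  have hmeas : ∀ S : Set (BondConfig V), MeasurableSet S := fun S => (Set.toFinite S).measurableSet
  set Dz : Set (BondConfig V) := (openConn x₁ z)ᶜ ∩ (openConn x₂ z)ᶜ with hDz
  set R1 : Set (BondConfig V) := {ω | (A.filter fun t => ω ∈ openConn x₁ t).card ≤ j} with hR1
  set R2 : Set (BondConfig V) := {ω | (A.filter fun t => ω ∈ openConn x₂ t).card ≤ j} with hR2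
  set B1 : Set (BondConfig V) := openConn x₁ b with hB1
  set B2 : Set (BondConfig V) := (openConn x₁ b)ᶜ ∩ openConn x₂ b with hB2
  set B0 : Set (BondConfig V) := (openConn x₁ b)ᶜ ∩ (openConn x₂ b)ᶜ with hB0
  set S := {ω : BondConfig V | ω ∉ openConn x₁ z ∧ ω ∉ openConn x₂ z ∧
        (((ω ∈ openConn x₁ b ∨ ω ∈ openConn x₂ b) ∧ (A.filter fun t => ω ∈ openConn b t).card ≤ j) ∨
          (ω ∉ openConn x₁ b ∧ ω ∉ openConn x₂ b ∧
            (A.filter fun t => ω ∈ openConn x₁ t ∨ ω ∈ openConn x₂ t).card ≤ j))} with hS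
  have filter_eq : ∀ (ω : BondConfig V) (u v : V), (openGraph ω).Reachable u v →
      (A.filter fun t => ω ∈ openConn v t) = (A.filter fun t => ω ∈ openConn u t) := by
    intro ω u v huv
    exact Finset.filter_congr fun t _ =>
      ⟨fun ht => (huv.trans ht : (openGraph ω).Reachable u t),
        fun ht => (huv.symm.trans ht : (openGraph ω).Reachable v t)⟩
  have eR1 : {ω : BondConfig V | ω ∉ openConn x₁ z ∧ ω ∉ openConn x₂ z ∧
      (A.filter fun t => ω ∈ openConn x₁ t).card ≤ j} = Dz ∩ R1 := by
    ext ω; simp only [hDz, hR1, mem_inter_iff, mem_compl_iff, mem_setOf_eq, and_assoc]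
  have eAp : {ω : BondConfig V | ω ∉ openConn x₁ z ∧ ω ∉ openConn x₂ z ∧ ω ∉ openConn x₁ b ∧ ω ∈ openConn x₂ b ∧
      (A.filter fun t => ω ∈ openConn x₂ t).card ≤ j ∧ ¬ (A.filter fun t => ω ∈ openConn x₁ t).card ≤ j} =
      Dz ∩ B2 ∩ (R2 ∩ R1ᶜ) := by
    ext ω; simp only [hDz, hR1, hR2, hB2, mem_inter_iff, mem_compl_iff, mem_setOf_eq, and_assoc]
  have eFm : {ω : BondConfig V | ω ∉ openConn x₁ z ∧ ω ∉ openConn x₂ z ∧ ω ∉ openConn x₁ b ∧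
      (A.filter fun t => ω ∈ openConn x₁ t).card ≤ j ∧ ¬ (A.filter fun t => ω ∈ openConn x₂ t).card ≤ j} =
      Dz ∩ (openConn x₁ b)ᶜ ∩ (R1 ∩ R2ᶜ) := by
    ext ω; simp only [hDz, hR1, hR2, mem_inter_iff, mem_compl_iff, mem_setOf_eq, and_assoc]
  rw [eR1, eAp, eFm]
  -- (a) S ∩ B1 ⊆ Dz ∩ R1 ∩ B1
  have hS1 : S ∩ B1 ⊆ Dz ∩ R1 ∩ B1 := by
    rintro ω ⟨hs, hb1⟩
    simp only [hS, mem_setOf_eq] at hs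
    obtain ⟨hz1, hz2, hrest⟩ := hs
    refine ⟨⟨⟨hz1, hz2⟩, ?_⟩, hb1⟩
    simp only [hR1, mem_setOf_eq]
    have hb1' : (openGraph ω).Reachable x₁ b := hb1
    rcases hrest with ⟨-, hRb⟩ | ⟨hnb1, -, -⟩
    · rw [filter_eq ω x₁ b hb1'] at hRb; exact hRb
    · exact absurd hb1 hnb1
  -- (b) S ∩ B0 ⊆ Dz ∩ (R1 ∩ R2) ∩ B0  (both pieces light)
  have hS0 : S ∩ B0 ⊆ Dz ∩ (R1 ∩ R2) ∩ B0 := by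
    rintro ω ⟨hs, hb0⟩
    simp only [hS, mem_setOf_eq] at hs
    obtain ⟨hz1, hz2, hrest⟩ := hs
    refine ⟨⟨⟨hz1, hz2⟩, ?_⟩, hb0⟩
    obtain ⟨hnb1, hnb2⟩ := hb0
    simp only [hR1, hR2, mem_inter_iff, mem_setOf_eq]
    rcases hrest with ⟨hbU, -⟩ | ⟨-, -, hU⟩
    · rcases hbU with h | h
      · exact absurd h hnb1
      · exact absurd h hnb2
    · constructor
      · refine le_trans (Finset.card_le_card ?_) hU
        intro t ht
        rw [Finset.mem_filter] at ht ⊢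
        exact ⟨ht.1, Or.inl ht.2⟩
      · refine le_trans (Finset.card_le_card ?_) hU
        intro t ht
        rw [Finset.mem_filter] at ht ⊢
        exact ⟨ht.1, Or.inr ht.2⟩
  -- (c) S ∩ B2 ⊆ Dz ∩ R2 ∩ B2
  have hS2 : S ∩ B2 ⊆ Dz ∩ R2 ∩ B2 := by
    rintro ω ⟨hs, hb2⟩
    simp only [hS, mem_setOf_eq] at hs
    obtain ⟨hz1, hz2, hrest⟩ := hs
    refine ⟨⟨⟨hz1, hz2⟩, ?_⟩, hb2⟩
    obtain ⟨hnb1, hb2'⟩ := hb2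
    simp only [hR2, mem_setOf_eq]
    have hb2'' : (openGraph ω).Reachable x₂ b := hb2'
    rcases hrest with ⟨-, hRb⟩ | ⟨-, hnb2, -⟩
    · rw [filter_eq ω x₂ b hb2''] at hRb; exact hRb
    · exact absurd hb2' hnb2
  -- (d) cover and disjointness
  have hcover : ∀ T : Set (BondConfig V), T ⊆ (T ∩ B1) ∪ (T ∩ B2) ∪ (T ∩ B0) := by
    intro T ω hω
    by_cases h1 : ω ∈ (openConn x₁ b : Set (BondConfig V))
    · exact Or.inl (Or.inl ⟨hω, h1⟩)
    by_cases h2 : ω ∈ (openConn x₂ b : Set (BondConfig V))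
    · exact Or.inl (Or.inr ⟨hω, ⟨h1, h2⟩⟩)
    · exact Or.inr ⟨hω, ⟨h1, h2⟩⟩
  have hd12 : ∀ T : Set (BondConfig V), Disjoint (T ∩ B1) (T ∩ B2) := by
    intro T; rw [Set.disjoint_left]
    rintro ω ⟨-, h1⟩ ⟨-, ⟨hn1, -⟩⟩; exact hn1 h1
  have hd10 : ∀ T : Set (BondConfig V), Disjoint (T ∩ B1) (T ∩ B0) := by
    intro T; rw [Set.disjoint_left]
    rintro ω ⟨-, h1⟩ ⟨-, ⟨hn1, -⟩⟩; exact hn1 h1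
  have hd20 : ∀ T : Set (BondConfig V), Disjoint (T ∩ B2) (T ∩ B0) := by
    intro T; rw [Set.disjoint_left]
    rintro ω ⟨-, ⟨-, h2⟩⟩ ⟨-, ⟨-, hn2⟩⟩; exact hn2 h2
  have hsplit : ∀ T : Set (BondConfig V), μ.real T = μ.real (T ∩ B1) + μ.real (T ∩ B2) + μ.real (T ∩ B0) := by
    intro T
    have hsub : (T ∩ B1) ∪ (T ∩ B2) ∪ (T ∩ B0) ⊆ T := by
      rintro ω ((⟨h, -⟩ | ⟨h, -⟩) | ⟨h, -⟩) <;> exact h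
    have heq : T = (T ∩ B1) ∪ (T ∩ B2) ∪ (T ∩ B0) := Subset.antisymm (hcover T) hsub
    have hd : Disjoint ((T ∩ B1) ∪ (T ∩ B2)) (T ∩ B0) := Disjoint.union_left (hd10 T) (hd20 T)
    calc μ.real T = μ.real ((T ∩ B1) ∪ (T ∩ B2) ∪ (T ∩ B0)) := by rw [← heq]
      _ = μ.real ((T ∩ B1) ∪ (T ∩ B2)) + μ.real (T ∩ B0) := measureReal_union hd (hmeas _)
      _ = μ.real (T ∩ B1) + μ.real (T ∩ B2) + μ.real (T ∩ B0) := by rw [measureReal_union (hd12 T) (hmeas _)]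
  -- (e) the pieces
  have hSle : μ.real S ≤ μ.real (Dz ∩ R1 ∩ B1) + μ.real (Dz ∩ R2 ∩ B2) + μ.real (Dz ∩ (R1 ∩ R2) ∩ B0) := by
    rw [hsplit S]
    linarith [measureReal_mono (μ := μ) hS1 (measure_ne_top _ _), measureReal_mono (μ := μ) hS2 (measure_ne_top _ _),
      measureReal_mono (μ := μ) hS0 (measure_ne_top _ _)]
  have hR1eq : μ.real (Dz ∩ R1) = μ.real (Dz ∩ R1 ∩ B1) + μ.real (Dz ∩ R1 ∩ B2) + μ.real (Dz ∩ R1 ∩ B0) :=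
    hsplit (Dz ∩ R1)
  -- (f) split the B2- and B0-pieces of `Dz ∩ R1` by the lightness of `x₂`
  have s1 : μ.real (Dz ∩ R1 ∩ B2 ∩ R2) + μ.real ((Dz ∩ R1 ∩ B2) \ R2) = μ.real (Dz ∩ R1 ∩ B2) :=
    measureReal_inter_add_sdiff (hmeas R2)
  have s2 : μ.real (Dz ∩ R2 ∩ B2 ∩ R1) + μ.real ((Dz ∩ R2 ∩ B2) \ R1) = μ.real (Dz ∩ R2 ∩ B2) :=
    measureReal_inter_add_sdiff (hmeas R1)
  have s0 : μ.real (Dz ∩ R1 ∩ B0 ∩ R2) + μ.real ((Dz ∩ R1 ∩ B0) \ R2) = μ.real (Dz ∩ R1 ∩ B0) :=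
    measureReal_inter_add_sdiff (hmeas R2)
  -- the subtracted set splits over B2 and B0
  have sF : μ.real (Dz ∩ (openConn x₁ b)ᶜ ∩ (R1 ∩ R2ᶜ)) =
      μ.real ((Dz ∩ R1 ∩ B2) \ R2) + μ.real ((Dz ∩ R1 ∩ B0) \ R2) := by
    have hd : Disjoint ((Dz ∩ R1 ∩ B2) \ R2) ((Dz ∩ R1 ∩ B0) \ R2) := by
      rw [Set.disjoint_left]
      rintro ω ⟨⟨⟨-, -⟩, ⟨-, h2⟩⟩, -⟩ ⟨⟨⟨-, -⟩, ⟨-, hn2⟩⟩, -⟩; exact hn2 h2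
    rw [← measureReal_union hd (hmeas _)]
    congr 1
    ext ω
    simp only [hB2, hB0, mem_inter_iff, mem_union, mem_sdiff, mem_compl_iff]
    constructor
    · rintro ⟨⟨hD, hn1⟩, hR1', hnR2⟩
      by_cases h2 : ω ∈ (openConn x₂ b : Set (BondConfig V))
      · exact Or.inl ⟨⟨⟨hD, hR1'⟩, hn1, h2⟩, hnR2⟩
      · exact Or.inr ⟨⟨⟨hD, hR1'⟩, hn1, h2⟩, hnR2⟩
    · rintro (⟨⟨⟨hD, hR1'⟩, hn1, -⟩, hnR2⟩ | ⟨⟨⟨hD, hR1'⟩, hn1, -⟩, hnR2⟩) <;> exact ⟨⟨hD, hn1⟩, hR1', hnR2⟩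
  have e1 : Dz ∩ R1 ∩ B2 ∩ R2 = Dz ∩ R2 ∩ B2 ∩ R1 := by
    ext ω; simp only [mem_inter_iff]; tauto
  have e3 : (Dz ∩ R2 ∩ B2) \ R1 = Dz ∩ B2 ∩ (R2 ∩ R1ᶜ) := by
    ext ω; simp only [mem_inter_iff, mem_sdiff, mem_compl_iff]; tauto
  have e0 : Dz ∩ R1 ∩ B0 ∩ R2 = Dz ∩ (R1 ∩ R2) ∩ B0 := by
    ext ω; simp only [mem_inter_iff]; tauto
  rw [e1] at s1
  rw [e3] at s2
  rw [e0] at s0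
  linarith

/-- **The bonus-free exchange implies the localized selection lemma LSL(2,1).**  If
`μ(D_z, b∈C(x₂)∖C(x₁), G₊)·μ(D_z, b∈C(x₁)∖C(x₂), G₋) ≤ μ(D_z, b∉C(x₁), G₋)·μ(D_z, b∉C(x₂), G₊)` then
`μ(D_z ∩ Ψ_b) ≤ max(μ(D_z ∩ R_{x₁}), μ(D_z ∩ R_{x₂}))` (crux memo §25). [folklore] -/
theorem lsl_pair_of_exchange [Fintype V] (w : Sym2 V → unitInterval) (A : Finset V) (x₁ x₂ z b : V) (j : ℕ)
    (hX : (prodBernoulli w).real {ω : BondConfig V | ω ∉ openConn x₁ z ∧ ω ∉ openConn x₂ z ∧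
              ω ∉ openConn x₁ b ∧ ω ∈ openConn x₂ b ∧
              (A.filter fun t => ω ∈ openConn x₂ t).card ≤ j ∧ ¬ (A.filter fun t => ω ∈ openConn x₁ t).card ≤ j} *
          (prodBernoulli w).real {ω : BondConfig V | ω ∉ openConn x₁ z ∧ ω ∉ openConn x₂ z ∧
              ω ∉ openConn x₂ b ∧ ω ∈ openConn x₁ b ∧
              (A.filter fun t => ω ∈ openConn x₁ t).card ≤ j ∧ ¬ (A.filter fun t => ω ∈ openConn x₂ t).card ≤ j} ≤
        (prodBernoulli w).real {ω : BondConfig V | ω ∉ openConn x₁ z ∧ ω ∉ openConn x₂ z ∧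
              ω ∉ openConn x₁ b ∧
              (A.filter fun t => ω ∈ openConn x₁ t).card ≤ j ∧ ¬ (A.filter fun t => ω ∈ openConn x₂ t).card ≤ j} *
          (prodBernoulli w).real {ω : BondConfig V | ω ∉ openConn x₁ z ∧ ω ∉ openConn x₂ z ∧
              ω ∉ openConn x₂ b ∧
              (A.filter fun t => ω ∈ openConn x₂ t).card ≤ j ∧ ¬ (A.filter fun t => ω ∈ openConn x₁ t).card ≤ j}) :
    (prodBernoulli w).real {ω : BondConfig V | ω ∉ openConn x₁ z ∧ ω ∉ openConn x₂ z ∧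
        (((ω ∈ openConn x₁ b ∨ ω ∈ openConn x₂ b) ∧ (A.filter fun t => ω ∈ openConn b t).card ≤ j) ∨
          (ω ∉ openConn x₁ b ∧ ω ∉ openConn x₂ b ∧
            (A.filter fun t => ω ∈ openConn x₁ t ∨ ω ∈ openConn x₂ t).card ≤ j))} ≤
      max ((prodBernoulli w).real {ω : BondConfig V | ω ∉ openConn x₁ z ∧ ω ∉ openConn x₂ z ∧
              (A.filter fun t => ω ∈ openConn x₁ t).card ≤ j})
          ((prodBernoulli w).real {ω : BondConfig V | ω ∉ openConn x₁ z ∧ ω ∉ openConn x₂ z ∧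
              (A.filter fun t => ω ∈ openConn x₂ t).card ≤ j}) := by
  set μ := prodBernoulli w with hμ
  have h1 := lsl_pair_le_add' w A x₁ x₂ z b j
  have h2 := lsl_pair_le_add' w A x₂ x₁ z b j
  have eS : {ω : BondConfig V | ω ∉ openConn x₂ z ∧ ω ∉ openConn x₁ z ∧
        (((ω ∈ openConn x₂ b ∨ ω ∈ openConn x₁ b) ∧ (A.filter fun t => ω ∈ openConn b t).card ≤ j) ∨
          (ω ∉ openConn x₂ b ∧ ω ∉ openConn x₁ b ∧
            (A.filter fun t => ω ∈ openConn x₂ t ∨ ω ∈ openConn x₁ t).card ≤ j))} =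
      {ω : BondConfig V | ω ∉ openConn x₁ z ∧ ω ∉ openConn x₂ z ∧
        (((ω ∈ openConn x₁ b ∨ ω ∈ openConn x₂ b) ∧ (A.filter fun t => ω ∈ openConn b t).card ≤ j) ∨
          (ω ∉ openConn x₁ b ∧ ω ∉ openConn x₂ b ∧
            (A.filter fun t => ω ∈ openConn x₁ t ∨ ω ∈ openConn x₂ t).card ≤ j))} := by
    ext ω
    have hf : (A.filter fun t => ω ∈ openConn x₂ t ∨ ω ∈ openConn x₁ t) =
        (A.filter fun t => ω ∈ openConn x₁ t ∨ ω ∈ openConn x₂ t) := Finset.filter_congr fun t _ => or_comm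
    simp only [mem_setOf_eq, hf]
    tauto
  have eR : ∀ (P : BondConfig V → Prop), {ω : BondConfig V | ω ∉ openConn x₂ z ∧ ω ∉ openConn x₁ z ∧ P ω} =
      {ω : BondConfig V | ω ∉ openConn x₁ z ∧ ω ∉ openConn x₂ z ∧ P ω} := by
    intro P; ext ω; simp only [mem_setOf_eq]; tauto
  rw [eS, eR, eR, eR] at h2
  set ap := μ.real {ω : BondConfig V | ω ∉ openConn x₁ z ∧ ω ∉ openConn x₂ z ∧ ω ∉ openConn x₁ b ∧ ω ∈ openConn x₂ b ∧
      (A.filter fun t => ω ∈ openConn x₂ t).card ≤ j ∧ ¬ (A.filter fun t => ω ∈ openConn x₁ t).card ≤ j} with hap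
  set fm := μ.real {ω : BondConfig V | ω ∉ openConn x₁ z ∧ ω ∉ openConn x₂ z ∧ ω ∉ openConn x₁ b ∧
      (A.filter fun t => ω ∈ openConn x₁ t).card ≤ j ∧ ¬ (A.filter fun t => ω ∈ openConn x₂ t).card ≤ j} with hfm
  set cm := μ.real {ω : BondConfig V | ω ∉ openConn x₁ z ∧ ω ∉ openConn x₂ z ∧ ω ∉ openConn x₂ b ∧ ω ∈ openConn x₁ b ∧
      (A.filter fun t => ω ∈ openConn x₁ t).card ≤ j ∧ ¬ (A.filter fun t => ω ∈ openConn x₂ t).card ≤ j} with hcm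
  set fp := μ.real {ω : BondConfig V | ω ∉ openConn x₁ z ∧ ω ∉ openConn x₂ z ∧ ω ∉ openConn x₂ b ∧
      (A.filter fun t => ω ∈ openConn x₂ t).card ≤ j ∧ ¬ (A.filter fun t => ω ∈ openConn x₁ t).card ≤ j} with hfp
  have hap0 : 0 ≤ ap := measureReal_nonneg
  have hfm0 : 0 ≤ fm := measureReal_nonneg
  have hcm0 : 0 ≤ cm := measureReal_nonneg
  have hfp0 : 0 ≤ fp := measureReal_nonneg
  by_cases hA : ap ≤ fm
  · exact le_max_of_le_left (by linarith)
  · by_cases hC : cm ≤ fp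
    · exact le_max_of_le_right (by linarith)
    · exfalso
      have hA' : fm < ap := not_le.1 hA
      have hC' : fp < cm := not_le.1 hC
      nlinarith [mul_pos (sub_pos.2 hA') (lt_of_le_of_lt hfp0 hC'), mul_nonneg hfm0 (sub_nonneg.2 hC'.le)]

end HullPort

end Summit.CriticalPhenomena.PercolationContinuityZ3.Theorems

end
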